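import Summits.MatrixMultiplication.OmegaCensus.ThreeSetZ5Z5Cover6Defs
import Summits.MatrixMultiplication.OmegaCensus.ThreeSetZ5LineTable4A
import Summits.MatrixMultiplication.OmegaCensus.ThreeSetZ5LineTable4B
import Summits.MatrixMultiplication.OmegaCensus.ThreeSetZ5Z5Data44A
import Summits.MatrixMultiplication.OmegaCensus.ThreeSetZ5Z5Data44C
import HarnessLib

/-!
# The three-set `ℤ₅ × ℤ₅` cover for parts `4, 4` at `|A| = 625`: line images of `W = T ∪ {c}`, certified-direction predicates

ω-census `pub-omega`, family (b3), seat pub-omega-group gen 36.  Framing: lottery ticket; floor = certified bounds/negative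
ranges.  VALUE: finite kernel data checks behind `ThreeSetZ5Z5Cells44.lean` (no cube symmetric form with `|W| = |X| = 4` over
`A ↠ ℤ₅ × ℤ₅` of order `625` — census cell `(4,4,13)@625`, four groups); NOT progress on ω.

A part `W` of size `4` normalises to `Φ'(W) = T ∪ {c}`, `T = {0, e₁, e₂}`, `c = pt 5 ci` (`ci < 25`, `c ∈ T` = a double point).
* `wvec44 ci j` — count vector of the line image of `T ∪ {pt 5 ci}` in direction `j` (`= wvec j + δ(pv 5 j ci)`); `tableFor4 w` — the
  certified modular table of a size-4 line image `w` (`ThreeSetZ5LineTable4A/B.lean`, 15 images), `ann_tableFor4` its kernel check;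
* `certHI ci j F` — HOLE-INDEPENDENT predicate (some entry with key `F` whose certificates exclude EVERY hole value): used for the 21
  frames whose cover is hole-independent; `certLP ci σ j F` — per-hole predicate for the four centroid frames `ci ∈ {12,19,23,24}`:
  a modular certificate at the hole value `pv 5 j σ` OR an LP certificate of `lp44` (`farkasOK5`, line fibre size `K = 125`, i.e.
  `|A| = 625`); bridges `lineCert3At_of_certHI`, `of_certLP`.
-/

namespace Summit.MatrixMultiplication.OmegaCensus

namespace Z5Z5ThreeSet

open Finset ZpZpDomino

/-! ## Order-specific LP (Farkas) certificates for the three-set line identity over `ZMod 5`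
(restated here for `q = 5`; the generic form is `ThreeSetLineLPCertificate.lean`, whose build is pending) -/

/-- **No three-set line identity over `ZMod 5` under an LP (Farkas) certificate at fibre size `K`**: `z` with `Σ_τ z(τ)M(τ,u) ≥ 0`
for all `u` and `K·Σz < z(s)` contradicts `Σ_u M(τ,u)G(u) + [s = τ] = K` (pair the identity with `z`). [folklore] -/
theorem no_lineMat3_identity_of_farkas5 (W F G : ZMod 5 → ℕ) (s : ZMod 5) (K : ℕ) (z : ZMod 5 → ℤ)
    (hz : ∀ u : ZMod 5, 0 ≤ ∑ τ : ZMod 5, z τ * (lineMat3 W F τ u : ℤ)) (hs : (K : ℤ) * ∑ τ : ZMod 5, z τ < z s)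
    (hid : ∀ τ : ZMod 5, (∑ u : ZMod 5, lineMat3 W F τ u * G u) + (if s = τ then 1 else 0) = K) : False := by
  have h1 : ∑ τ : ZMod 5, z τ * (((∑ u : ZMod 5, lineMat3 W F τ u * G u) + (if s = τ then 1 else 0) : ℕ) : ℤ) =
      ∑ τ : ZMod 5, z τ * (K : ℤ) := sum_congr rfl fun τ _ => by rw [hid τ]
  have h2 : ∑ τ : ZMod 5, z τ * (((∑ u : ZMod 5, lineMat3 W F τ u * G u) + (if s = τ then 1 else 0) : ℕ) : ℤ) =
      (∑ u : ZMod 5, (G u : ℤ) * ∑ τ : ZMod 5, z τ * (lineMat3 W F τ u : ℤ)) + z s := by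
    have e : ∀ τ : ZMod 5, z τ * (((∑ u : ZMod 5, lineMat3 W F τ u * G u) + (if s = τ then 1 else 0) : ℕ) : ℤ) =
        (∑ u : ZMod 5, z τ * ((lineMat3 W F τ u : ℤ) * (G u : ℤ))) + (if s = τ then z τ else 0) := by
      intro τ
      push_cast
      rw [mul_add, mul_sum]
      congr 1
      split_ifs <;> simp
    rw [sum_congr rfl fun τ _ => e τ, sum_add_distrib, sum_ite_eq, if_pos (mem_univ _), sum_comm]
    congr 1
    refine sum_congr rfl fun u _ => ?_
    rw [mul_sum]
    exact sum_congr rfl fun τ _ => by ring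
  have h3 : ∑ τ : ZMod 5, z τ * (K : ℤ) = (K : ℤ) * ∑ τ : ZMod 5, z τ := by
    rw [mul_sum]; exact sum_congr rfl fun τ _ => mul_comm _ _
  have h4 : 0 ≤ ∑ u : ZMod 5, (G u : ℤ) * ∑ τ : ZMod 5, z τ * (lineMat3 W F τ u : ℤ) :=
    sum_nonneg fun u _ => mul_nonneg (by positivity) (hz u)
  rw [h2, h3] at h1
  linarith

/-- A list sum over `range 5` is a sum over `ZMod 5` through `val` (integer-valued). [folklore] -/
theorem sum_range5_eq_sum_zmod5 (g : ℕ → ℤ) : ((List.range 5).map g).sum = ∑ v : ZMod 5, g v.val := by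
  have h : ((List.range 5).map g).sum = g 0 + g 1 + g 2 + g 3 + g 4 := by
    simp [List.range_succ, add_assoc]
  rw [h]
  exact (Fin.sum_univ_five (fun v : Fin 5 => g v.val)).symm

/-- **LP certificate check in pure `ℤ` list arithmetic** (`q = 5`): `z` of length `5`, `Σ_τ z(τ)·M(τ,u) ≥ 0` for all `u < 5`
(matrix `lineMat3Nat`) and `K·Σz < z(s)`. [folklore] -/
def farkasOK5 (W F : List ℕ) (K : ℕ) (z : List ℤ) (s : ℕ) : Bool :=
  (z.length == 5) && ((List.range 5).all fun u =>
    decide (0 ≤ ((List.range 5).map fun τ => z.getD τ 0 * (lineMat3Nat W F τ u : ℤ)).sum)) &&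
    decide ((K : ℤ) * z.sum < z.getD s 0)

/-- **Soundness of `farkasOK5`**: no `G` satisfies the three-set line identity for `(vecFn W, vecFn F)`, hole value `s`, fibre size
`K`. [folklore] -/
theorem false_of_farkasOK5 {W F : List ℕ} {K : ℕ} {z : List ℤ} {s : ℕ} (hs5 : s < 5) (h : farkasOK5 W F K z s = true)
    (G : ZMod 5 → ℕ)
    (hid : ∀ τ : ZMod 5, (∑ u : ZMod 5, lineMat3 (vecFn W) (vecFn F) τ u * G u) +
      (if ((s : ℕ) : ZMod 5) = τ then 1 else 0) = K) : False := by
  simp only [farkasOK5, Bool.and_eq_true, beq_iff_eq, List.all_eq_true, List.mem_range, decide_eq_true_eq] at h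
  obtain ⟨⟨hlen, hz⟩, hlt⟩ := h
  refine no_lineMat3_identity_of_farkas5 (vecFn W) (vecFn F) G ((s : ℕ) : ZMod 5) K (fun τ => z.getD τ.val 0)
    (fun u => ?_) ?_ hid
  · have e : ∑ τ : ZMod 5, z.getD τ.val 0 * (lineMat3 (vecFn W) (vecFn F) τ u : ℤ) =
        ((List.range 5).map fun τ => z.getD τ 0 * (lineMat3Nat W F τ u.val : ℤ)).sum := by
      rw [sum_range5_eq_sum_zmod5 (fun n => z.getD n 0 * (lineMat3Nat W F n u.val : ℤ))]
      exact sum_congr rfl fun τ _ => by rw [lineMat3_vecFn]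
    rw [e]; exact hz u.val (ZMod.val_lt u)
  · have hsum : ∑ τ : ZMod 5, z.getD τ.val 0 = z.sum := by
      rw [← sum_range5_eq_sum_zmod5 (fun n => z.getD n 0)]
      match z, hlen with
      | [a, b, c, d, e], _ => simp [List.range_succ]
    rw [hsum, ZMod.val_natCast, Nat.mod_eq_of_lt hs5]
    exact hlt

/-- Count vector of the line image of `T ∪ {pt 5 ci}` in direction `j ≤ 5`. [folklore] -/
def wvec44 (ci j : ℕ) : List ℕ := List.ofFn fun v : Fin 5 => (wvec j).getD v.val 0 + if pv 5 j ci = v.val then 1 else 0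

/-- The certified modular tables of the size-`4` line images, as an association list (15 images). [folklore] -/
def tabs4 : List (List ℕ × List (List ℕ × List (ℕ × List ℕ))) := [
  ([1, 1, 0, 0, 2], table4_11002),
  ([1, 1, 0, 1, 1], table4_11011),
  ([1, 1, 0, 2, 0], table4_11020),
  ([1, 1, 1, 0, 1], table4_11101),
  ([1, 1, 1, 1, 0], table4_11110),
  ([1, 1, 2, 0, 0], table4_11200),
  ([1, 2, 0, 0, 1], table4_12001),
  ([1, 2, 0, 1, 0], table4_12010),
  ([1, 2, 1, 0, 0], table4_12100),
  ([1, 3, 0, 0, 0], table4_13000),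
  ([2, 1, 0, 0, 1], table4_21001),
  ([2, 1, 0, 1, 0], table4_21010),
  ([2, 1, 1, 0, 0], table4_21100),
  ([2, 2, 0, 0, 0], table4_22000),
  ([3, 1, 0, 0, 0], table4_31000)]

/-- The certified modular table of a size-`4` line image (empty for images that do not occur). [folklore] -/
def tableFor4 (w : List ℕ) : List (List ℕ × List (ℕ × List ℕ)) :=
  match tabs4.find? (fun p => p.1 == w) with
  | some p => p.2
  | none => []

/-- **All fifteen tables pass the annihilation check** (pure-`ℕ` `annOKNat`, one kernel computation). [folklore] -/
theorem ann_tabs4 : (tabs4.all fun p => p.2.all fun e => annOKNat p.1 e.1 e.2) = true := by decide +kernel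

/-- **Every dispatched table passes the annihilation check.** [folklore] -/
theorem ann_tableFor4 (w : List ℕ) : ((tableFor4 w).all fun e => annOKNat w e.1 e.2) = true := by
  unfold tableFor4
  cases h : tabs4.find? (fun p => p.1 == w) with
  | none => rfl
  | some p =>
    have hp : p ∈ tabs4 := List.mem_of_find?_eq_some h
    have hw : p.1 = w := by simpa using List.find?_some h
    have ha := ann_tabs4
    rw [List.all_eq_true] at ha
    have := ha p hp
    rw [hw] at this
    exact this

/-- **Hole-independent certified-direction predicate**: an entry of the table of `wvec44 ci j` with key `F` whose certificate list
excludes every hole value `v < 5`. [folklore] -/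
def certHI (ci j : ℕ) (F : List ℕ) : Bool :=
  (tableFor4 (wvec44 ci j)).any fun e => e.1 == F && (List.range 5).all fun v => exclOK e.2 v

/-- **Per-hole predicate for the centroid frames**: a modular certificate at the hole value of direction `j`, or an LP certificate
of `lp44` at `K = 125`. [folklore] -/
def certLP (ci σ j : ℕ) (F : List ℕ) : Bool :=
  ((tableFor4 (wvec44 ci j)).any fun e => e.1 == F && exclOK e.2 (pv 5 j σ)) ||
    (lp44.any fun e => e.1 == wvec44 ci j && e.2.1 == F && e.2.2.1 == pv 5 j σ && farkasOK5 e.1 e.2.1 125 e.2.2.2 e.2.2.1)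

/-- From `certHI` to a passing `lineCert3At` at EVERY hole value. [folklore] -/
theorem lineCert3At_of_certHI {ci j : ℕ} {F : List ℕ} (h : certHI ci j F = true) (v : ℕ) (hv : v < 5) :
    ∃ certs : List (ℕ × List ℕ), lineCert3At 5 (vecFn (wvec44 ci j)) (vecFn F) certs ((v : ℕ) : ZMod 5) = true := by
  simp only [certHI, List.any_eq_true, Bool.and_eq_true, beq_iff_eq, List.all_eq_true, List.mem_range] at h
  obtain ⟨e, he, h1, h2⟩ := h
  have ha := ann_tableFor4 (wvec44 ci j)
  rw [List.all_eq_true] at ha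
  have h3 := ha e he
  rw [h1] at h3
  exact ⟨e.2, lineCert3At_of_nat hv h3 (h2 v hv)⟩

/-- From `certLP` to a passing modular certificate at the hole value of direction `j`, or a passing LP certificate at `K = 125`.
[folklore] -/
theorem of_certLP {ci σ j : ℕ} {F : List ℕ} (h : certLP ci σ j F = true) :
    (∃ certs : List (ℕ × List ℕ), lineCert3At 5 (vecFn (wvec44 ci j)) (vecFn F) certs ((pv 5 j σ : ℕ) : ZMod 5) = true) ∨
      ∃ z : List ℤ, farkasOK5 (wvec44 ci j) F 125 z (pv 5 j σ) = true := by
  unfold certLP at h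
  rw [Bool.or_eq_true] at h
  rcases h with h | h
  · left
    rw [List.any_eq_true] at h
    obtain ⟨e, he, h'⟩ := h
    rw [Bool.and_eq_true, beq_iff_eq] at h'
    obtain ⟨h1, h2⟩ := h'
    have ha := ann_tableFor4 (wvec44 ci j)
    rw [List.all_eq_true] at ha
    have h3 := ha e he
    rw [h1] at h3
    exact ⟨e.2, lineCert3At_of_nat (pv_lt 5 j σ) h3 h2⟩
  · right
    rw [List.any_eq_true] at h
    obtain ⟨e, -, h'⟩ := h
    rw [Bool.and_eq_true, Bool.and_eq_true, Bool.and_eq_true, beq_iff_eq, beq_iff_eq, beq_iff_eq] at h'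
    obtain ⟨⟨⟨h1, h2⟩, h3⟩, h4⟩ := h'
    refine ⟨e.2.2.2, ?_⟩
    rw [← h1, ← h2, ← h3]
    exact h4

end Z5Z5ThreeSet

end Summit.MatrixMultiplication.OmegaCensus
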